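import Literature.RepresentationTheory.FiniteGroups.GL2ModularPrincipalSeriesTorusLines
import Mathlib.Algebra.BigOperators.Fin
import HarnessLib

/-!
# The Mackey functional of the big `(T, B)` double coset: an explicit `(B, χ₁ ⊗ χ₂)`-eigenfunctional on
# `Fun(GL₂(F), W)` (right translation), `Φ ↦ Σ_{b ∈ B} χ(b)⁻¹ Φ(v(s₀) b)`

Topic `Literature/RepresentationTheory/FiniteGroups`, namespace `Literature.RepresentationTheory.FiniteGroups.GL2`.
Two definitions (`borelElt`, `mackeyFunctional`) + THEOREMS; no named fact, no instance, no notation, no `sorry`.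

For a finite field `F`, a commutative ring `R`, an `R`-module `W`, characters `χ₁ χ₂ : Fˣ → Rˣ`, a lower unipotent
`v(s₀) = (1 0; s₀ 1)` and a function `Φ : GL₂(F) → W`, put
`mackeyFunctional χ₁ χ₂ s₀ Φ := Σ_{t₁ t₂ ∈ Fˣ, a ∈ F} χ₁(t₁)⁻¹χ₂(t₂)⁻¹ • Φ(v(s₀) · diag(t₁,t₂) · u(a))`, the sum over the
Borel subgroup `B = {diag(t₁,t₂)u(a)}` (`borelElt`, `coe_borel_eq_borelElt`).  It is `R`-linear in `Φ` and an EIGENFUNCTIONAL for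
the right-translation action of `B` with character `χ(b) = χ₁(b₀₀)χ₂(b₁₁)` (`borelCharacter`):

* **`mackeyFunctional_translate`** : `mackeyFunctional (x ↦ Φ(x·b)) = χ(b) • mackeyFunctional Φ` for `b ∈ B`
  (reindex the sum by `b' ↦ b'b`; steps `…_translate_upperUnip`, `…_translate_diagElt`).

This is the functional attached by Mackey's decomposition `B\GL₂(F)/T ↔ {∞, 0, generic}` to the GENERIC double coset
`T·v(s₀)·B` [SerreLinearRepresentations1977, §7.3–7.4; Bump1997, §4.1 (Bruhat decomposition)]; on `T`-left-invariant functions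
with `χ₁χ₂ = 1` it is (up to the factor `|Z|`) the unique `(B, χ)`-eigenfunctional of `Ind_T^G(𝟙)`.  Consumer: route
BSD/TeichmullerTwistDescent (crux `TwistedPeriodLatticeSaturation`): composed with the spread period map of the full-level
carrier it is the candidate Borel eigenfunctional of the K-line input (I1‴), reducing it to a NONVANISHING (I1⁗).

## References
* J.-P. Serre, *Linear Representations of Finite Groups* (1977), §7.3 (Mackey's criterion / double cosets), §7.4.
  [SerreLinearRepresentations1977]
* D. Bump, *Automorphic Forms and Representations* (1997), §4.1 Eq. (1.6)–(1.7). [Bump1997]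
-/

noncomputable section

namespace Literature.RepresentationTheory.FiniteGroups

namespace GL2

open Function Matrix

section Mackey

variable {F : Type} [Field F] {R : Type} [CommRing R] {W : Type} [AddCommGroup W] [Module R W]
  (χ₁ χ₂ : Fˣ →* Rˣ)

variable (F) in
/-- The Borel element `diag(t₁, t₂) · u(a) = (t₁ t₁a; 0 t₂)`. [cite: Bump1997, §4.1 Eq. (1.6)] -/
def borelElt (t₁ t₂ : Fˣ) (a : F) : GL (Fin 2) F := diagElt F t₁ t₂ * upperUnip F a

/-- `borelElt t₁ t₂ a ∈ B`. [cite: Bump1997, §4.1 Eq. (1.6)] -/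
theorem borelElt_mem_borel (t₁ t₂ : Fˣ) (a : F) : borelElt F t₁ t₂ a ∈ borel F :=
  (borel F).mul_mem (diagElt_mem_borel F t₁ t₂) (upperUnip_mem_borel F a)

/-- `χ(diag(t₁,t₂) u(a)) = χ₁(t₁) χ₂(t₂)`. [cite: Bump1997, §4.1 Eq. (1.6)] -/
theorem borelCharacter_borelElt (t₁ t₂ : Fˣ) (a : F) :
    borelCharacter F χ₁ χ₂ ⟨borelElt F t₁ t₂ a, borelElt_mem_borel t₁ t₂ a⟩ = χ₁ t₁ * χ₂ t₂ := by
  have : (⟨borelElt F t₁ t₂ a, borelElt_mem_borel t₁ t₂ a⟩ : borel F) =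
      ⟨diagElt F t₁ t₂, diagElt_mem_borel F t₁ t₂⟩ * ⟨upperUnip F a, upperUnip_mem_borel F a⟩ := rfl
  rw [this, map_mul, borelCharacter_diagElt, borelCharacter_upperUnip, mul_one]

/-- **Every Borel element is `diag(b₀₀, b₁₁) · u(b₀₁/b₀₀)`.** [cite: Bump1997, §4.1 Eq. (1.6)] -/
theorem coe_borel_eq_borelElt (b : borel F) :
    (b : GL (Fin 2) F) = borelElt F (borelFst b) (borelSnd b)
      (((b : GL (Fin 2) F) : Matrix (Fin 2) (Fin 2) F) 0 1 / ((b : GL (Fin 2) F) : Matrix (Fin 2) (Fin 2) F) 0 0) := by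
  have h10 : ((b : GL (Fin 2) F) : Matrix (Fin 2) (Fin 2) F) 1 0 = 0 := (mem_borel_iff _).mp b.2
  have h00 : ((b : GL (Fin 2) F) : Matrix (Fin 2) (Fin 2) F) 0 0 ≠ 0 := by
    rw [← coe_borelFst]; exact (borelFst b).ne_zero
  refine Matrix.GeneralLinearGroup.ext fun i j => ?_
  rw [borelElt, Matrix.GeneralLinearGroup.coe_mul, coe_diagElt, coe_upperUnip, coe_borelFst, coe_borelSnd]
  fin_cases i <;> fin_cases j <;> simp [Matrix.mul_apply, Fin.sum_univ_two, h10]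
  field_simp

/-- `u(a) u(c) = u(a + c)` inside a Borel element. [cite: Bump1997, §4.1 Eq. (1.7)] -/
theorem borelElt_mul_upperUnip (t₁ t₂ : Fˣ) (a c : F) :
    borelElt F t₁ t₂ a * upperUnip F c = borelElt F t₁ t₂ (a + c) := by
  rw [borelElt, borelElt, mul_assoc, ← upperUnip_add]

/-- `diag(t₁,t₂) u(a) diag(s₁,s₂) = diag(t₁s₁, t₂s₂) u(a s₂/s₁)`. [cite: Bump1997, §4.1 Eq. (1.7)] -/
theorem borelElt_mul_diagElt (t₁ t₂ s₁ s₂ : Fˣ) (a : F) :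
    borelElt F t₁ t₂ a * diagElt F s₁ s₂ = borelElt F (t₁ * s₁) (t₂ * s₂) (a * s₂ / s₁) := by
  refine Matrix.GeneralLinearGroup.ext fun i j => ?_
  simp only [borelElt, coe_diagElt, coe_upperUnip, Units.val_mul]
  fin_cases i <;> fin_cases j <;> simp [Matrix.mul_apply, Fin.sum_univ_two]
  field_simp

variable [Fintype F] [DecidableEq F]

/-- **The Mackey functional** of the generic `(T, B)` double coset through `v(s₀)`:
`Φ ↦ Σ_{t₁ t₂ a} χ₁(t₁)⁻¹χ₂(t₂)⁻¹ • Φ(v(s₀) diag(t₁,t₂) u(a))`, `R`-linear in `Φ : GL₂(F) → W`.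
[cite: SerreLinearRepresentations1977, §7.3] -/
def mackeyFunctional (s₀ : F) : (GL (Fin 2) F → W) →ₗ[R] W where
  toFun Φ := ∑ x : Fˣ × Fˣ × F, (((χ₁ x.1)⁻¹ * (χ₂ x.2.1)⁻¹ : Rˣ) : R) • Φ (lowerUnip F s₀ * borelElt F x.1 x.2.1 x.2.2)
  map_add' Φ Ψ := by
    rw [← Finset.sum_add_distrib]
    exact Finset.sum_congr rfl fun x _ => by rw [Pi.add_apply, smul_add]
  map_smul' c Φ := by
    rw [RingHom.id_apply, Finset.smul_sum]
    exact Finset.sum_congr rfl fun x _ => by rw [Pi.smul_apply, smul_comm]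

/-- Unfolding. [cite: SerreLinearRepresentations1977, §7.3] -/
theorem mackeyFunctional_apply (s₀ : F) (Φ : GL (Fin 2) F → W) :
    mackeyFunctional χ₁ χ₂ s₀ Φ =
      ∑ x : Fˣ × Fˣ × F, (((χ₁ x.1)⁻¹ * (χ₂ x.2.1)⁻¹ : Rˣ) : R) • Φ (lowerUnip F s₀ * borelElt F x.1 x.2.1 x.2.2) :=
  rfl

/-- Translation by `u(c)`: the functional is INVARIANT (`χ(u(c)) = 1`). [cite: SerreLinearRepresentations1977, §7.3] -/
theorem mackeyFunctional_translate_upperUnip (s₀ : F) (Φ : GL (Fin 2) F → W) (c : F) :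
    mackeyFunctional χ₁ χ₂ s₀ (fun x => Φ (x * upperUnip F c)) = mackeyFunctional χ₁ χ₂ s₀ Φ := by
  rw [mackeyFunctional_apply, mackeyFunctional_apply]
  -- reindex `a ↦ a + c`
  let e : Fˣ × Fˣ × F ≃ Fˣ × Fˣ × F :=
    { toFun := fun x => (x.1, x.2.1, x.2.2 + c)
      invFun := fun x => (x.1, x.2.1, x.2.2 - c)
      left_inv := fun x => by simp
      right_inv := fun x => by simp }
  refine Fintype.sum_equiv e _ _ fun x => ?_
  change _ = (((χ₁ x.1)⁻¹ * (χ₂ x.2.1)⁻¹ : Rˣ) : R) • Φ (lowerUnip F s₀ * borelElt F x.1 x.2.1 (x.2.2 + c))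
  rw [mul_assoc, borelElt_mul_upperUnip]

/-- Translation by `diag(s₁, s₂)`: the functional is multiplied by `χ₁(s₁)χ₂(s₂)`.
[cite: SerreLinearRepresentations1977, §7.3] -/
theorem mackeyFunctional_translate_diagElt (s₀ : F) (Φ : GL (Fin 2) F → W) (s₁ s₂ : Fˣ) :
    mackeyFunctional χ₁ χ₂ s₀ (fun x => Φ (x * diagElt F s₁ s₂)) =
      ((χ₁ s₁ * χ₂ s₂ : Rˣ) : R) • mackeyFunctional χ₁ χ₂ s₀ Φ := by
  rw [mackeyFunctional_apply, mackeyFunctional_apply, Finset.smul_sum]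
  -- reindex `(t₁, t₂, a) ↦ (t₁ s₁, t₂ s₂, a s₂ / s₁)`
  have hs₁ : ((s₁ : F)) ≠ 0 := s₁.ne_zero
  have hs₂ : ((s₂ : F)) ≠ 0 := s₂.ne_zero
  let e : Fˣ × Fˣ × F ≃ Fˣ × Fˣ × F :=
    { toFun := fun x => (x.1 * s₁, x.2.1 * s₂, x.2.2 * s₂ / s₁)
      invFun := fun x => (x.1 * s₁⁻¹, x.2.1 * s₂⁻¹, x.2.2 * s₁ / s₂)
      left_inv := fun x => by
        refine Prod.ext (by simp) (Prod.ext (by simp) ?_)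
        change x.2.2 * s₂ / s₁ * s₁ / s₂ = x.2.2
        field_simp
      right_inv := fun x => by
        refine Prod.ext (by simp) (Prod.ext (by simp) ?_)
        change x.2.2 * s₁ / s₂ * s₂ / s₁ = x.2.2
        field_simp }
  refine Fintype.sum_equiv e _ _ fun x => ?_
  change _ = _ • ((((χ₁ (x.1 * s₁))⁻¹ * (χ₂ (x.2.1 * s₂))⁻¹ : Rˣ) : R) •
    Φ (lowerUnip F s₀ * borelElt F (x.1 * s₁) (x.2.1 * s₂) (x.2.2 * s₂ / s₁)))
  rw [mul_assoc, borelElt_mul_diagElt, smul_smul]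
  congr 1
  -- the coefficient identity `χ₁(t₁)⁻¹χ₂(t₂)⁻¹ = χ₁(s₁)χ₂(s₂) · χ₁(t₁s₁)⁻¹ χ₂(t₂s₂)⁻¹`
  have h1 : ((χ₁ s₁ : Rˣ) : R) * (((χ₁ s₁)⁻¹ : Rˣ) : R) = 1 := by
    rw [← Units.val_mul, mul_inv_cancel, Units.val_one]
  have h2 : ((χ₂ s₂ : Rˣ) : R) * (((χ₂ s₂)⁻¹ : Rˣ) : R) = 1 := by
    rw [← Units.val_mul, mul_inv_cancel, Units.val_one]
  simp only [map_mul, mul_inv, Units.val_mul]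
  linear_combination (-((((χ₁ x.1)⁻¹ : Rˣ) : R) * (((χ₂ x.2.1)⁻¹ : Rˣ) : R) *
      (((χ₂ s₂ : Rˣ) : R) * (((χ₂ s₂)⁻¹ : Rˣ) : R)))) * h1 +
    (-((((χ₁ x.1)⁻¹ : Rˣ) : R) * (((χ₂ x.2.1)⁻¹ : Rˣ) : R))) * h2

/-- **The Mackey functional is a `(B, χ₁ ⊗ χ₂)`-eigenfunctional for right translation**:
`mackeyFunctional (x ↦ Φ(x b)) = χ(b) • mackeyFunctional Φ` for every `b ∈ B`. [cite: SerreLinearRepresentations1977, §7.3] -/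
theorem mackeyFunctional_translate (s₀ : F) (Φ : GL (Fin 2) F → W) (b : borel F) :
    mackeyFunctional χ₁ χ₂ s₀ (fun x => Φ (x * b)) = (borelCharacter F χ₁ χ₂ b : R) • mackeyFunctional χ₁ χ₂ s₀ Φ := by
  set c := ((b : GL (Fin 2) F) : Matrix (Fin 2) (Fin 2) F) 0 1 / ((b : GL (Fin 2) F) : Matrix (Fin 2) (Fin 2) F) 0 0
  have hb : (b : GL (Fin 2) F) = diagElt F (borelFst b) (borelSnd b) * upperUnip F c := coe_borel_eq_borelElt b
  have hχ : (borelCharacter F χ₁ χ₂ b : R) = ((χ₁ (borelFst b) * χ₂ (borelSnd b) : Rˣ) : R) := by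
    rw [borelCharacter_apply]
  have h1 : (fun x => Φ (x * (b : GL (Fin 2) F))) =
      fun x => (fun y => Φ (y * upperUnip F c)) (x * diagElt F (borelFst b) (borelSnd b)) := by
    funext x; simp only [hb, mul_assoc]
  have h2 := mackeyFunctional_translate_diagElt χ₁ χ₂ s₀ (fun y => Φ (y * upperUnip F c)) (borelFst b) (borelSnd b)
  have h3 := mackeyFunctional_translate_upperUnip χ₁ χ₂ s₀ Φ c
  rw [h1, h2, h3, hχ]

end Mackey

end GL2

end Literature.RepresentationTheory.FiniteGroups
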